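import Literature.AlgebraicGeometry.Resolution.ArithmeticalThreefoldsLocalTower
import Literature.AlgebraicGeometry.Resolution.ArithmeticalThreefoldsReduction
import Mathlib.FieldTheory.PurelyInseparable.Basic
import Mathlib.FieldTheory.KummerPolynomial
import Mathlib.FieldTheory.Relrank
import HarnessLib

/-!
# Cossart–Piltant's tower, the purely inseparable part: climbing `K ⊇ F` purely inseparable

Topic: `Literature/AlgebraicGeometry/Resolution`. PROOF side of `CossartPiltant2019ReductionP`
(`ArithmeticalThreefoldsLocal.lean`), continued: `ArithmeticalThreefoldsReduction.lean` reduces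
the named fact to a climbing statement over the Cohen subring `S` (models `S[t] ⊆ 𝒪_v` of finite
extensions `K` of `F = Frac S` inside an ambient field, regular at the centre of `v`), and
`ArithmeticalThreefoldsLocalTower.lean` mechanises one degree-`p` step of the climb. Here the
PURELY INSEPARABLE part of the climb is carried out (Cossart–Piltant 2019, proof of Prop. 4.10,
arXiv v1 p. 54):

> "We first indicate how to reduce to the case where the finite field extension `K | F` is
> separable. Let `K | K^{sep}` be the subextension of maximal separable `F`-extension, and
> `A ⊆ A^{sep}` … By [EGA IV 7.7.3] … It follows that `K | K^{sep}` is a tower of purely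
> inseparable extensions of degree `p`. … `(LU)` for `A^{sep}` implies `(LU)` for `A` …
> theorem 1.5 (i) with `h := X^p − x`."

* `isIntegral_and_finrank_adjoin_eq_of_pow_mem` — `x ∉ M`, `x^p ∈ M` (characteristic `p`):
  `[M(x) : M] = p`, `X^p − x^p` being irreducible;
* `isRegularLocalRing_centre_adjoin_empty` — the base of the climb, the model `S[∅]` (its local
  ring at the centre is `S`, regular);
* `CossartPiltant2019Local.exists_model_adjoin_of_pow_mem` — **one purely inseparable step in
  the ambient field**: from climbing data at a subfield `M ∋ S` (a model `S[t]`, `t ⊆ M ⊆ F(t)`,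
  `S[t] ⊆ O_Ω` regular at the centre) and `x ∉ M` with `x^p ∈ S[t]`, climbing data at `M(x)` —
  the local theorem in case (i) over `S[t]_P` (`CossartPiltant2019Local.exists_model_step` with
  `K := M`, `L := M(x)` as types, and transport back to `Ω`);
* `CossartPiltant2019Local.exists_model_of_forall_pow_mem` — **the induction** on `[E : M]`:
  pick `z ∈ E ∖ M` with `z^p ∈ M`, rescale by a denominator of `z^p` to `x` with `x^p ∈ S[t]`
  (so the coefficients of `h = X^p − x^p` lie in the model — NO principalization is needed for
  this), step, and recurse;
* `CossartPiltant2019Local.climb_of_forall_pow_mem` — **the purely inseparable climb in the shape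
  of the hypothesis `CLIMB` of `cossartPiltant2019ReductionP_of_climb`**, for finite `s₀ ⊆ Ω`
  generating over `F` an extension all of whose elements have a `p^k`-th power in `F`.

What remains for `CossartPiltant2019ReductionP_holds` is the separable part of the climb: the
ramification-theoretic tower `F ⊆ Fⁱ ⊆ Fʳ ⊆ Kʳ ⊇ Kⁱ ⊇ K` (Galois approximation Prop. 4.13,
[CoP1] Cor. 7.3, Props. 6.3, 9.1, 9.3, principalization Prop. 4.4, and Thm. 1.5 (ii) for the
degree-`p` Galois steps, for which `exists_model_step` is again the tool).

Everything is PROVED; no named facts are introduced (the local theorem enters as the hypothesis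
`hloc : CossartPiltant2019Local`).

## Sources

* V. Cossart, O. Piltant, J. Algebra 529 (2019) 268–535 = arXiv:1412.0868: journal Thm. 1.5 (i)
  and proof of Prop. 4.10 (arXiv v1: Thm. 1.4 p. 4; Prop. 4.8, proof pp. 53–54). [CossartPiltant2019]
-/

noncomputable section

open IsLocalRing Polynomial IntermediateField

namespace Literature.AlgebraicGeometry.Resolution

universe u

/-! ## Bookkeeping -/

/-- Elements of the subfield generated by `S` and `t` are fractions of elements of `S[t]`.
[folklore] -/
theorem exists_div_eq_of_mem_closure {S Ω : Type u} [CommRing S] [Field Ω] [Algebra S Ω]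
    (t : Set Ω) {z : Ω} (hz : z ∈ Subfield.closure (Set.range (algebraMap S Ω) ∪ t)) :
    ∃ a b : Ω, a ∈ Algebra.adjoin S t ∧ b ∈ Algebra.adjoin S t ∧ b ≠ 0 ∧ z = a / b := by
  obtain ⟨y, hy, w, hw, hyw⟩ := Subfield.mem_closure_iff.mp hz
  rw [← Algebra.adjoin_eq_ring_closure] at hy hw
  by_cases hw0 : w = 0
  · refine ⟨0, 1, zero_mem _, one_mem _, one_ne_zero, ?_⟩
    rw [← hyw, hw0, div_zero, zero_div]
  · exact ⟨y, w, hy, hw, hw0, hyw.symm⟩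

/-- **A radical generator of a purely inseparable step** (characteristic `p`): if `x ∉ M` and
`x^p ∈ M` then `X^p − x^p` is the minimal polynomial of `x` over `M`, so `x` is integral over `M`
and `[M(x) : M] = p`. [folklore] -/
theorem isIntegral_and_finrank_adjoin_eq_of_pow_mem {Ω : Type u} [Field Ω] (p : ℕ) [hp : Fact p.Prime]
    [CharP Ω p] (M : Subfield Ω) {x : Ω} (hxM : x ∉ M) (hxp : x ^ p ∈ M) :
    IsIntegral M x ∧ Module.finrank M (IntermediateField.adjoin M ({x} : Set Ω)) = p := by
  haveI : CharP M p := inferInstance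
  let c : M := ⟨x ^ p, hxp⟩
  have hirr : Irreducible (X ^ p - C c) := by
    refine X_pow_sub_C_irreducible_of_prime hp.out fun b hb => hxM ?_
    have hb' : (b : Ω) ^ p = x ^ p := by
      have := congrArg (fun t : M => (t : Ω)) hb
      simpa using this
    have h0 : ((b : Ω) - x) ^ p = 0 := by rw [sub_pow_char, hb', sub_self]
    have hbx : (b : Ω) = x := sub_eq_zero.mp ((pow_eq_zero_iff hp.out.ne_zero).mp h0)
    rw [← hbx]
    exact b.2
  have hmonic : (X ^ p - C c).Monic := monic_X_pow_sub_C c hp.out.ne_zero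
  have haeval : aeval x (X ^ p - C c) = 0 := by
    rw [map_sub, aeval_X_pow, aeval_C, sub_eq_zero]
    rfl
  have hint : IsIntegral M x := ⟨X ^ p - C c, hmonic, by rwa [← aeval_def]⟩
  have hmin : minpoly M x = X ^ p - C c :=
    (minpoly.eq_of_irreducible_of_monic hirr haeval hmonic).symm
  refine ⟨hint, ?_⟩
  rw [IntermediateField.adjoin.finrank hint, hmin, natDegree_X_pow_sub_C]

/-- **The base of the climb in the ambient field**: for an injective `S → Ω` from a regular local
ring into a field and a valuation ring `O_Ω ∋ S` dominating `S`, the model `S[∅] ⊆ Ω` is regular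
at the centre (its local ring is `S`). [folklore] -/
theorem isRegularLocalRing_centre_adjoin_empty {S Ω : Type u} [CommRing S] [IsDomain S]
    [IsRegularLocalRing S] [Field Ω] [Algebra S Ω] (hinj : Function.Injective (algebraMap S Ω))
    (OΩ : ValuationSubring Ω) (hSO : ∀ s : S, algebraMap S Ω s ∈ OΩ)
    (hdom : ∀ s ∈ maximalIdeal S, OΩ.valuation (algebraMap S Ω s) < 1)
    (hTO : (Algebra.adjoin S (((∅ : Finset Ω) : Finset Ω) : Set Ω)).toSubring ≤ OΩ.toSubring) :
    IsRegularLocalRing (Localization.AtPrime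
      (Ideal.comap (Subring.inclusion hTO) (maximalIdeal OΩ))) := by
  classical
  have hmemT : ∀ y : Ω, y ∈ Algebra.adjoin S (((∅ : Finset Ω) : Finset Ω) : Set Ω) ↔
      ∃ a : S, algebraMap S Ω a = y := fun y => by
    rw [Finset.coe_empty, Algebra.adjoin_empty, Algebra.mem_bot, Set.mem_range]
  set T : Subring Ω := (Algebra.adjoin S (((∅ : Finset Ω) : Finset Ω) : Set Ω)).toSubring
    with hTdef
  set P : Ideal T := Ideal.comap (Subring.inclusion hTO) (maximalIdeal OΩ) with hPdef
  have hmem : ∀ a : S, algebraMap S Ω a ∈ T := fun a => (hmemT _).mpr ⟨a, rfl⟩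
  let f : S →+* T := (algebraMap S Ω).codRestrict T hmem
  have hf : ∀ a, ((f a : T) : Ω) = algebraMap S Ω a := fun _ => rfl
  have hfinj : Function.Injective f := fun a b h => hinj (by rw [← hf a, ← hf b, h])
  have hfsurj : Function.Surjective f := fun y => by
    obtain ⟨c, hc⟩ := (hmemT y).mp y.2
    exact ⟨c, Subtype.ext hc⟩
  let e : S ≃+* T := RingEquiv.ofBijective f ⟨hfinj, hfsurj⟩
  have hPmem : ∀ a : S, e a ∈ P ↔ a ∈ maximalIdeal S := by
    intro a
    rw [hPdef, Ideal.mem_comap, ValuationSubring.valuation_lt_one_iff]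
    change OΩ.valuation (algebraMap S Ω a) < 1 ↔ _
    constructor
    · intro hlt
      by_contra hna
      have hu : IsUnit a := by
        by_contra hnu
        exact hna ((IsLocalRing.mem_maximalIdeal a).mpr hnu)
      obtain ⟨b, hb⟩ := hu.exists_right_inv
      have h1 : OΩ.valuation (algebraMap S Ω a) = 1 :=
        valuation_eq_one_of_mul_eq_one OΩ (hSO a) (hSO b) (by rw [← map_mul, hb, map_one])
      exact (lt_irrefl _) (h1 ▸ hlt)
    · exact hdom a
  have hunits : P.primeCompl ≤ IsUnit.submonoid T := by
    intro y hy
    obtain ⟨a, rfl⟩ := e.surjective y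
    have ha : a ∉ maximalIdeal S := fun h => hy ((hPmem a).mpr h)
    have hu : IsUnit a := by
      by_contra hnu
      exact ha ((IsLocalRing.mem_maximalIdeal a).mpr hnu)
    exact hu.map e
  haveI : IsLocalization P.primeCompl T := IsLocalization.self hunits
  let g : T ≃ₐ[T] Localization.AtPrime P :=
    IsLocalization.algEquiv P.primeCompl T (Localization.AtPrime P)
  haveI : IsRegularLocalRing T := IsRegularLocalRing.of_ringEquiv e
  exact IsRegularLocalRing.of_ringEquiv g.toRingEquiv

/-! ## The data of the climb at a subfield `M ⊆ Ω` -/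

section Climb

variable {S Ω : Type u} [CommRing S] [IsDomain S] [IsLocalRing S] [Field Ω] [Algebra S Ω]
  (OΩ : ValuationSubring Ω)

/-- **One purely inseparable degree-`p` step, in the ambient field** (Cossart–Piltant 2019,
proof of Prop. 4.10, arXiv v1 p. 54: "`K | K^{sep}` is a tower of purely inseparable extensions
of degree `p`; `(LU)` for `A^{sep}` implies `(LU)` for `A` via Thm. 1.5 (i) with `h = X^p − x`").
Data: `M ⊆ Ω` a subfield containing `S`, a model `S[t] ⊆ O_Ω` (`t ⊆ M`) with
`M ⊆ Frac(S)(t)` regular at the centre of `O_Ω`, and `x ∈ Ω ∖ M` with `x^p ∈ S[t]` (any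
`z ∉ M` with `z^p ∈ M` may be rescaled to such an `x` by a denominator of `z^p`). Conclusion:
the same data for the subfield `M(x)`: a model `S[t'] ⊆ O_Ω`, `t' ⊆ M(x) ⊆ Frac(S)(t')`,
regular at the centre. The local theorem is applied in case (i) over the local ring of `S[t]`
through `CossartPiltant2019Local.exists_model_step` (with `K := M`, `L := M(x)` as types).
[cite: CossartPiltant2019, proof of Prop. 4.10 (arXiv v1: Prop. 4.8, p. 54) with Thm. 1.5 (i)] -/
theorem CossartPiltant2019Local.exists_model_adjoin_of_pow_mem (hloc : CossartPiltant2019Local.{u})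
    (p : ℕ) [hp : Fact p.Prime] [CharP Ω p] [Algebra.IsAlgebraic S Ω]
    (hinj : Function.Injective (algebraMap S Ω))
    (hS : IsExcellentRing S) (hSdim : ringKrullDim S = 3) (hSchar : CharP (ResidueField S) p)
    (hSO : ∀ s : S, algebraMap S Ω s ∈ OΩ)
    (hdom : ∀ s ∈ maximalIdeal S, OΩ.valuation (algebraMap S Ω s) < 1)
    (hres : ∀ y : OΩ, ∃ q : S[X], (∃ i, q.coeff i ∉ maximalIdeal S) ∧
      OΩ.valuation (q.eval₂ (algebraMap S Ω) y) < 1)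
    (M : Subfield Ω) (hSM : ∀ s : S, algebraMap S Ω s ∈ M)
    (t : Finset Ω) (htM : (t : Set Ω) ⊆ M)
    (hMcl : M ≤ Subfield.closure (Set.range (algebraMap S Ω) ∪ (t : Set Ω)))
    (hTO : (Algebra.adjoin S (t : Set Ω)).toSubring ≤ OΩ.toSubring)
    (hreg : IsRegularLocalRing (Localization.AtPrime
      (Ideal.comap (Subring.inclusion hTO) (maximalIdeal OΩ))))
    (x : Ω) (hxM : x ∉ M) (hxp : x ^ p ∈ Algebra.adjoin S (t : Set Ω)) :
    ∃ t' : Finset Ω,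
      (t' : Set Ω) ⊆ (IntermediateField.adjoin M ({x} : Set Ω)).toSubfield ∧
      (IntermediateField.adjoin M ({x} : Set Ω)).toSubfield ≤
        Subfield.closure (Set.range (algebraMap S Ω) ∪ (t' : Set Ω)) ∧
      ∃ hTO' : (Algebra.adjoin S (t' : Set Ω)).toSubring ≤ OΩ.toSubring,
        IsRegularLocalRing (Localization.AtPrime
          (Ideal.comap (Subring.inclusion hTO') (maximalIdeal OΩ))) := by
  classical
  haveI : IsNoetherianRing S := hS.isUniversallyCatenaryRing.1
  -- the base field `K = M` as a type, with `S → K`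
  let K : Type u := M
  letI : Algebra S K := ((algebraMap S Ω).codRestrict M hSM).toAlgebra
  haveI : IsScalarTower S K Ω := IsScalarTower.of_algebraMap_eq fun _ => rfl
  haveI : FaithfulSMul S K := (faithfulSMul_iff_algebraMap_injective _ _).mpr fun a b hab =>
    hinj (by
      have := congrArg (fun z : K => (z : Ω)) hab
      exact this)
  haveI : Algebra.IsAlgebraic S K :=
    Algebra.IsAlgebraic.of_injective (IsScalarTower.toAlgHom S K Ω) Subtype.val_injective
  let val : K →ₐ[S] Ω := IsScalarTower.toAlgHom S K Ω
  have hval : ∀ z : K, val z = (z : Ω) := fun _ => rfl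
  -- the step field `L = M(x)` as a type
  let Lx : IntermediateField K Ω := IntermediateField.adjoin K ({x} : Set Ω)
  let L : Type u := Lx
  letI : Algebra S L := ((algebraMap K L).comp (algebraMap S K)).toAlgebra
  haveI : IsScalarTower S K L := IsScalarTower.of_algebraMap_eq fun _ => rfl
  haveI : IsScalarTower S L Ω := IsScalarTower.of_algebraMap_eq fun _ => rfl
  let valL : L →ₐ[S] Ω := IsScalarTower.toAlgHom S L Ω
  have hvalL : ∀ z : L, valL z = (z : Ω) := fun _ => rfl
  -- the model at level `K`
  have hrange : ∀ e ∈ t, e ∈ Set.range (fun z : K => (z : Ω)) := fun e he =>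
    ⟨⟨e, htM (Finset.mem_coe.mpr he)⟩, rfl⟩
  let tK : Finset K := t.preimage (fun z : K => (z : Ω)) Subtype.val_injective.injOn
  have htK : tK.image (fun z : K => (z : Ω)) = t := by
    rw [Finset.image_preimage]
    exact Finset.filter_true_of_mem hrange
  have htK' : val '' ((tK : Finset K) : Set K) = (t : Set Ω) := by
    rw [← htK, Finset.coe_image]
    rfl
  have hRmap : (Algebra.adjoin S ((tK : Finset K) : Set K)).map val = Algebra.adjoin S (t : Set Ω) := by
    rw [AlgHom.map_adjoin, htK']
  have hRmem : ∀ z : Algebra.adjoin S ((tK : Finset K) : Set K), (z : Ω) ∈ Algebra.adjoin S (t : Set Ω) :=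
    fun z => by
      rw [← hRmap]
      exact Subalgebra.mem_map.mpr ⟨z, z.2, rfl⟩
  have hRpre : ∀ w : Ω, w ∈ Algebra.adjoin S (t : Set Ω) →
      ∃ z : Algebra.adjoin S ((tK : Finset K) : Set K), (z : Ω) = w := fun w hw => by
    rw [← hRmap] at hw
    obtain ⟨z, hz, hzw⟩ := Subalgebra.mem_map.mp hw
    exact ⟨⟨z, hz⟩, hzw⟩
  -- `Frac S[t_K] = K`
  have hfrac : IsFractionRing (Algebra.adjoin S ((tK : Finset K) : Set K)) K := by
    haveI : FaithfulSMul (Algebra.adjoin S ((tK : Finset K) : Set K)) K :=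
      (faithfulSMul_iff_algebraMap_injective _ _).mpr Subtype.val_injective
    refine IsFractionRing.of_field _ K fun z => ?_
    obtain ⟨a, b, ha, hb, hb0, hzab⟩ := exists_div_eq_of_mem_closure (t : Set Ω) (hMcl z.2)
    obtain ⟨a', ha'⟩ := hRpre a ha
    obtain ⟨b', hb'⟩ := hRpre b hb
    refine ⟨a', b', Subtype.ext ?_⟩
    change (z : Ω) = ((a' : K) : Ω) / ((b' : K) : Ω)
    rw [hzab]
    exact congrArg₂ (· / ·) ha'.symm hb'.symm
  -- the valuation on `L`, and the model seen from `L`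
  let OL : ValuationSubring L := OΩ.comap (algebraMap L Ω)
  have hOLv : ∀ z : L, OL.valuation z < 1 ↔ OΩ.valuation (z : Ω) < 1 := fun z =>
    valuation_comap_lt_one_iff OΩ (algebraMap L Ω) z
  have hTO_L : ∀ z : Algebra.adjoin S ((tK : Finset K) : Set K), algebraMap K L z ∈ OL := fun z => by
    change ((z : K) : Ω) ∈ OΩ
    exact hTO (hRmem z)
  -- the centre on `S[t_K]`
  let ιO : Algebra.adjoin S ((tK : Finset K) : Set K) →+* OΩ :=
    ((algebraMap K Ω).comp (Algebra.adjoin S ((tK : Finset K) : Set K)).val.toRingHom).codRestrict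
      OΩ (fun z => hTO (hRmem z))
  let P : Ideal (Algebra.adjoin S ((tK : Finset K) : Set K)) := (maximalIdeal OΩ).comap ιO
  haveI : P.IsPrime := Ideal.IsPrime.comap _
  have hPΩ : ∀ z : Algebra.adjoin S ((tK : Finset K) : Set K), z ∈ P ↔ OΩ.valuation ((z : K) : Ω) < 1 :=
    fun z => by
      rw [Ideal.mem_comap, ValuationSubring.valuation_lt_one_iff]
      rfl
  have hP : ∀ z : Algebra.adjoin S ((tK : Finset K) : Set K), z ∈ P ↔ OL.valuation (algebraMap K L z) < 1 :=
    fun z => by rw [hPΩ, hOLv]; rfl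
  -- regularity at level `K`, transported from `Ω`
  set PΩ : Ideal (Algebra.adjoin S (t : Set Ω)) :=
    Ideal.comap (Subring.inclusion hTO) (maximalIdeal OΩ) with hPΩdef
  haveI : PΩ.IsPrime := Ideal.IsPrime.comap _
  have hPΩmem : ∀ w : Algebra.adjoin S (t : Set Ω), w ∈ PΩ ↔ OΩ.valuation (w : Ω) < 1 := fun w => by
    rw [hPΩdef, Ideal.mem_comap, ValuationSubring.valuation_lt_one_iff]; rfl
  have hmapO : ((Algebra.adjoin S ((tK : Finset K) : Set K)).map val).toSubring ≤ OΩ.toSubring := by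
    rw [hRmap]; exact hTO
  set Q : Ideal ((Algebra.adjoin S ((tK : Finset K) : Set K)).map val) :=
    Ideal.comap (Subring.inclusion hmapO) (maximalIdeal OΩ) with hQdef
  haveI : Q.IsPrime := Ideal.IsPrime.comap _
  have hQ : ∀ y : (Algebra.adjoin S ((tK : Finset K) : Set K)).map val, y ∈ Q ↔ OΩ.valuation (y : Ω) < 1 :=
    fun y => by rw [hQdef, Ideal.mem_comap, ValuationSubring.valuation_lt_one_iff]; rfl
  have hregQ : IsRegularLocalRing (Localization.AtPrime Q) :=
    (isRegularLocalRing_localization_iff_of_subalgebra_eq OΩ hRmap Q hQ PΩ hPΩmem).mpr hreg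
  have hregK : IsRegularLocalRing (Localization.AtPrime P) :=
    (isRegularLocalRing_localization_map_iff val OΩ _ P (fun z => by rw [hPΩ]; rfl) Q hQ).mpr hregQ
  -- the generator `x` as an element of `L`, and its minimal polynomial `X^p − c₀` over `S[t_K]`
  obtain ⟨c₀, hc₀⟩ := hRpre (x ^ p) hxp
  let xL : L := IntermediateField.AdjoinSimple.gen K x
  have hxL : (xL : Ω) = x := IntermediateField.AdjoinSimple.coe_gen K x
  let h : (Algebra.adjoin S ((tK : Finset K) : Set K))[X] := X ^ p - C c₀
  have hmon : h.Monic := monic_X_pow_sub_C c₀ hp.out.ne_zero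
  have hdeg : h.natDegree = p := natDegree_X_pow_sub_C
  have hmapK : h.map (algebraMap _ K) = X ^ p - C (c₀ : K) := by
    simp only [h, Polynomial.map_sub, Polynomial.map_pow, Polynomial.map_X, Polynomial.map_C]
    rfl
  haveI : CharP K p := inferInstance
  have hirr : Irreducible (h.map (algebraMap _ K)) := by
    rw [hmapK]
    refine X_pow_sub_C_irreducible_of_prime hp.out fun b hb => hxM ?_
    have hb' : (b : Ω) ^ p = x ^ p := by
      have h1 : ((b : K) : Ω) ^ p = ((c₀ : K) : Ω) := by
        have := congrArg (fun z : K => (z : Ω)) hb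
        exact this
      exact h1.trans hc₀
    have h0 : ((b : Ω) - x) ^ p = 0 := by rw [sub_pow_char, hb', sub_self]
    have hbx : (b : Ω) = x := sub_eq_zero.mp ((pow_eq_zero_iff hp.out.ne_zero).mp h0)
    rw [← hbx]
    exact b.2
  have haevalΩ : aeval x (X ^ p - C (c₀ : K)) = 0 := by
    rw [map_sub, aeval_X_pow, aeval_C, sub_eq_zero]
    exact hc₀.symm
  have hxaeval : aeval xL (h.map (algebraMap _ K)) = 0 := by
    rw [hmapK]
    have h1 := aeval_algHom_apply (IsScalarTower.toAlgHom K L Ω) xL (X ^ p - C (c₀ : K))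
    have h2 : (IsScalarTower.toAlgHom K L Ω) xL = x := hxL
    rw [h2, haevalΩ] at h1
    exact (algebraMap L Ω).injective (h1.symm.trans (map_zero _).symm)
  obtain ⟨hint, hfin⟩ := isIntegral_and_finrank_adjoin_eq_of_pow_mem p M hxM (hc₀ ▸ (c₀ : K).2)
  have hgen : Algebra.adjoin K ({xL} : Set L) = ⊤ := by
    have := PowerBasis.adjoin_gen_eq_top (IntermediateField.adjoin.powerBasis hint)
    rwa [IntermediateField.adjoin.powerBasis_gen] at this
  have hcoeff : ∀ i, 0 < i → i < p → h.coeff i = 0 := fun i hi hip => by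
    simp only [h, coeff_sub, coeff_X_pow, coeff_C, if_neg hip.ne, if_neg hi.ne', sub_self]
  -- the valuation data at level `L`
  have hSO_L : ∀ s : S, algebraMap S L s ∈ OL := fun s => by
    change algebraMap L Ω (algebraMap S L s) ∈ OΩ
    rw [← IsScalarTower.algebraMap_apply]
    exact hSO s
  have hdom_L : ∀ s ∈ maximalIdeal S, OL.valuation (algebraMap S L s) < 1 := fun s hs => by
    rw [hOLv]
    change OΩ.valuation (algebraMap L Ω (algebraMap S L s)) < 1
    rw [← IsScalarTower.algebraMap_apply]
    exact hdom s hs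
  have hres_L : ∀ y : OL, ∃ q : S[X], (∃ i, q.coeff i ∉ maximalIdeal S) ∧
      OL.valuation (q.eval₂ (algebraMap S L) y) < 1 := fun y => by
    obtain ⟨q, hq, hv⟩ := hres ⟨algebraMap L Ω y, y.2⟩
    refine ⟨q, hq, ?_⟩
    rw [hOLv]
    change OΩ.valuation (algebraMap L Ω (q.eval₂ (algebraMap S L) y)) < 1
    rw [Polynomial.hom_eval₂, ← IsScalarTower.algebraMap_eq]
    exact hv
  -- the local theorem, case (i)
  obtain ⟨t', hTO', hfrac', hreg'⟩ := CossartPiltant2019Local.exists_model_step hloc p hp.out hS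
    hSdim hSchar OL hSO_L hdom_L hres_L tK hTO_L hfrac P hP hregK h xL hmon hdeg hirr hxaeval hgen
    (Or.inl ⟨inferInstance, hcoeff⟩)
  -- back to `Ω`
  haveI := hfrac'
  let t'' : Finset Ω := t'.image (fun z : L => (z : Ω))
  have ht'' : valL '' ((t' : Finset L) : Set L) = ((t'' : Finset Ω) : Set Ω) := by
    rw [Finset.coe_image]
    rfl
  have hmap' : (Algebra.adjoin S ((t' : Finset L) : Set L)).map valL =
      Algebra.adjoin S ((t'' : Finset Ω) : Set Ω) := by
    rw [AlgHom.map_adjoin, ht'']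
  refine ⟨t'', ?_, ?_, ?_⟩
  · intro w hw
    obtain ⟨z, -, rfl⟩ := Finset.mem_image.mp (Finset.mem_coe.mp hw)
    exact (IntermediateField.mem_toSubfield _ _).mpr z.2
  · intro w hw
    let wL : L := ⟨w, (IntermediateField.mem_toSubfield _ _).mp hw⟩
    obtain ⟨a, b, hb, hab⟩ := IsFractionRing.div_surjective (A := Algebra.adjoin S ((t' : Finset L) : Set L)) wL
    have hmemcl : ∀ z : Algebra.adjoin S ((t' : Finset L) : Set L),
        ((z : L) : Ω) ∈ Subfield.closure (Set.range (algebraMap S Ω) ∪ ((t'' : Finset Ω) : Set Ω)) := by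
      intro z
      have h1 : ((z : L) : Ω) ∈ Algebra.adjoin S ((t'' : Finset Ω) : Set Ω) := by
        rw [← hmap']
        exact Subalgebra.mem_map.mpr ⟨z, z.2, rfl⟩
      have h2 : ((z : L) : Ω) ∈ (Algebra.adjoin S ((t'' : Finset Ω) : Set Ω)).toSubring := h1
      rw [Algebra.adjoin_eq_ring_closure] at h2
      exact Subfield.subring_closure_le _ h2
    have hw' : w = ((a : L) : Ω) / ((b : L) : Ω) := by
      have := congrArg (fun z : L => (z : Ω)) hab
      change ((algebraMap _ L a / algebraMap _ L b : L) : Ω) = w at this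
      rw [← this]
      rfl
    rw [hw']
    exact div_mem (hmemcl a) (hmemcl b)
  · have hTO'' : (Algebra.adjoin S ((t'' : Finset Ω) : Set Ω)).toSubring ≤ OΩ.toSubring := by
      intro w hw
      rw [← hmap'] at hw
      obtain ⟨z, hz, rfl⟩ := Subalgebra.mem_map.mp hw
      exact hTO' hz
    refine ⟨hTO'', ?_⟩
    -- transport the regularity from `L` to `Ω`
    set P₁ : Ideal (Algebra.adjoin S ((t' : Finset L) : Set L)) :=
      Ideal.comap (Subring.inclusion hTO') (maximalIdeal OL) with hP₁def
    have hP₁ : ∀ z : Algebra.adjoin S ((t' : Finset L) : Set L), z ∈ P₁ ↔ OΩ.valuation (valL z) < 1 :=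
      fun z => by
        rw [hP₁def, Ideal.mem_comap, ValuationSubring.valuation_lt_one_iff, hvalL]
        exact hOLv _
    set Q₁ : Ideal ((Algebra.adjoin S ((t' : Finset L) : Set L)).map valL) :=
      Ideal.comap (Subring.inclusion (show ((Algebra.adjoin S ((t' : Finset L) : Set L)).map valL).toSubring ≤
        OΩ.toSubring by rw [hmap']; exact hTO'')) (maximalIdeal OΩ) with hQ₁def
    haveI : Q₁.IsPrime := Ideal.IsPrime.comap _
    have hQ₁ : ∀ y : (Algebra.adjoin S ((t' : Finset L) : Set L)).map valL, y ∈ Q₁ ↔ OΩ.valuation (y : Ω) < 1 :=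
      fun y => by rw [hQ₁def, Ideal.mem_comap, ValuationSubring.valuation_lt_one_iff]; rfl
    have hregQ₁ : IsRegularLocalRing (Localization.AtPrime Q₁) :=
      (isRegularLocalRing_localization_map_iff valL OΩ _ P₁ hP₁ Q₁ hQ₁).mp hreg'
    set P₂ : Ideal (Algebra.adjoin S ((t'' : Finset Ω) : Set Ω)) :=
      Ideal.comap (Subring.inclusion hTO'') (maximalIdeal OΩ) with hP₂def
    haveI : P₂.IsPrime := Ideal.IsPrime.comap _
    exact (isRegularLocalRing_localization_iff_of_subalgebra_eq OΩ hmap' Q₁ hQ₁ P₂ (fun y => by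
      rw [hP₂def, Ideal.mem_comap, ValuationSubring.valuation_lt_one_iff]; rfl)).mp hregQ₁

/-- **Climbing a purely inseparable tower** (Cossart–Piltant 2019, proof of Prop. 4.10, arXiv v1
p. 54: "(LU) for `A^{sep}` implies (LU) for `A`" along `K ⊇ K^{sep}`, a tower of purely
inseparable extensions of degree `p`), by induction on `[E : M]`: for subfields `M ≤ E` of `Ω`
with `S ⊆ M` and `E | M` of finite degree with `z^{p^k} ∈ M` for all `z ∈ E`, the climbing data
at `M` (a model `S[t] ⊆ O_Ω`, `t ⊆ M ⊆ Frac(S)(t)`, regular at the centre) yield climbing data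
at `E`. Each step picks `z ∈ E ∖ M` with `z^p ∈ M`, rescales it by a denominator into `x`
with `x^p ∈ S[t]`, and applies `CossartPiltant2019Local.exists_model_adjoin_of_pow_mem`.
[cite: CossartPiltant2019, proof of Prop. 4.10 (arXiv v1: Prop. 4.8, p. 54)] -/
theorem CossartPiltant2019Local.exists_model_of_forall_pow_mem (hloc : CossartPiltant2019Local.{u})
    (p : ℕ) [hp : Fact p.Prime] [CharP Ω p] [Algebra.IsAlgebraic S Ω]
    (hinj : Function.Injective (algebraMap S Ω))
    (hS : IsExcellentRing S) (hSdim : ringKrullDim S = 3) (hSchar : CharP (ResidueField S) p)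
    (hSO : ∀ s : S, algebraMap S Ω s ∈ OΩ)
    (hdom : ∀ s ∈ maximalIdeal S, OΩ.valuation (algebraMap S Ω s) < 1)
    (hres : ∀ y : OΩ, ∃ q : S[X], (∃ i, q.coeff i ∉ maximalIdeal S) ∧
      OΩ.valuation (q.eval₂ (algebraMap S Ω) y) < 1) (n : ℕ) :
    ∀ (M E : Subfield Ω), M ≤ E → (∀ s : S, algebraMap S Ω s ∈ M) →
      (∀ z ∈ E, ∃ k : ℕ, z ^ p ^ k ∈ M) → Subfield.relfinrank M E = n → 0 < n →
      (∃ t : Finset Ω, (t : Set Ω) ⊆ M ∧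
        M ≤ Subfield.closure (Set.range (algebraMap S Ω) ∪ (t : Set Ω)) ∧
        ∃ hTO : (Algebra.adjoin S (t : Set Ω)).toSubring ≤ OΩ.toSubring,
          IsRegularLocalRing (Localization.AtPrime
            (Ideal.comap (Subring.inclusion hTO) (maximalIdeal OΩ)))) →
      ∃ t : Finset Ω, (t : Set Ω) ⊆ E ∧
        E ≤ Subfield.closure (Set.range (algebraMap S Ω) ∪ (t : Set Ω)) ∧
        ∃ hTO : (Algebra.adjoin S (t : Set Ω)).toSubring ≤ OΩ.toSubring,
          IsRegularLocalRing (Localization.AtPrime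
            (Ideal.comap (Subring.inclusion hTO) (maximalIdeal OΩ))) := by
  classical
  induction n using Nat.strong_induction_on with
  | _ n ih =>
  intro M E hME hSM hpow hn hn0 hINV
  by_cases hEM : E ≤ M
  · obtain rfl : M = E := le_antisymm hME hEM
    exact hINV
  obtain ⟨y, hyE, hyM⟩ := Set.not_subset.mp hEM
  have hex : ∃ k : ℕ, y ^ p ^ k ∈ M := hpow y hyE
  let k := Nat.find hex
  have hk : y ^ p ^ k ∈ M := Nat.find_spec hex
  have hk0 : k ≠ 0 := by
    intro h0
    rw [h0, pow_zero, pow_one] at hk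
    exact hyM hk
  set z : Ω := y ^ p ^ (k - 1) with hz
  have hzE : z ∈ E := E.pow_mem hyE _
  have hzM : z ∉ M := Nat.find_min hex (Nat.sub_one_lt hk0)
  have hzp : z ^ p ∈ M := by
    rw [hz, ← pow_mul, ← pow_succ, Nat.sub_one_add_one hk0]
    exact hk
  -- rescale `z` into `x` with `x^p ∈ S[t]`
  obtain ⟨t, htM, hMcl, hTO, hreg⟩ := hINV
  have hTM : ∀ w ∈ Algebra.adjoin S (t : Set Ω), w ∈ M := by
    intro w hw
    refine Algebra.adjoin_induction (p := fun w _ => w ∈ M) (fun w hw => htM hw) (fun s => hSM s)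
      (fun _ _ _ _ hx hy => add_mem hx hy) (fun _ _ _ _ hx hy => mul_mem hx hy) hw
  obtain ⟨a, b, ha, hb, hb0, hzab⟩ := exists_div_eq_of_mem_closure (t : Set Ω) (hMcl hzp)
  set x : Ω := b * z with hxdef
  have hxM : x ∉ M := fun hxM => hzM (by
    have : z = x / b := by rw [hxdef, mul_div_cancel_left₀ _ hb0]
    rw [this]
    exact div_mem hxM (hTM b hb))
  have hxE : x ∈ E := mul_mem (hME (hTM b hb)) hzE
  have hxp : x ^ p ∈ Algebra.adjoin S (t : Set Ω) := by
    have : x ^ p = b ^ (p - 1) * a := by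
      have hp1 : p = (p - 1) + 1 := (Nat.sub_one_add_one hp.out.ne_zero).symm
      rw [hxdef, mul_pow, hzab]
      conv_lhs => rw [hp1, pow_succ]
      rw [mul_assoc, ← mul_div_assoc, mul_div_cancel_left₀ a hb0]
    rw [this]
    exact mul_mem (pow_mem hb _) ha
  -- the step `M ≤ M(x)`
  obtain ⟨t₁, ht₁M, hM₁cl, hTO₁, hreg₁⟩ :=
    CossartPiltant2019Local.exists_model_adjoin_of_pow_mem OΩ hloc p hinj hS hSdim hSchar hSO hdom
      hres M hSM t htM hMcl hTO hreg x hxM hxp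
  obtain ⟨hint, hfin⟩ := isIntegral_and_finrank_adjoin_eq_of_pow_mem p M hxM (hTM _ hxp)
  let Mx : IntermediateField M Ω := IntermediateField.adjoin M ({x} : Set Ω)
  have hMMx : M ≤ Mx.toSubfield := fun w hw => Mx.algebraMap_mem ⟨w, hw⟩
  have hMxE : Mx.toSubfield ≤ E := by
    have : Mx ≤ Subfield.extendScalars hME := by
      rw [IntermediateField.adjoin_le_iff]
      rintro _ rfl
      exact hxE
    exact fun w hw => this hw
  have hext : Subfield.extendScalars hMMx = Mx :=
    IntermediateField.toSubfield_injective (Subfield.extendScalars_toSubfield hMMx)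
  have hrel : Subfield.relfinrank M Mx.toSubfield = p := by
    rw [Subfield.relfinrank_eq_finrank_of_le hMMx, hext, hfin]
  have hmul : p * Subfield.relfinrank Mx.toSubfield E = n := by
    rw [← hrel, Subfield.relfinrank_mul_relfinrank hMMx hMxE, hn]
  have hpos : 0 < Subfield.relfinrank Mx.toSubfield E := by
    rcases Nat.eq_zero_or_pos (Subfield.relfinrank Mx.toSubfield E) with h0 | h0
    · rw [h0, mul_zero] at hmul; omega
    · exact h0
  have hlt : Subfield.relfinrank Mx.toSubfield E < n := by
    rw [← hmul]
    calc Subfield.relfinrank Mx.toSubfield E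
          = 1 * Subfield.relfinrank Mx.toSubfield E := (one_mul _).symm
      _ < p * Subfield.relfinrank Mx.toSubfield E := Nat.mul_lt_mul_of_pos_right hp.out.one_lt hpos
  exact ih _ hlt Mx.toSubfield E hMxE (fun s => hMMx (hSM s))
    (fun w hw => by obtain ⟨j, hj⟩ := hpow w hw; exact ⟨j, hMMx hj⟩) rfl hpos
    ⟨t₁, ht₁M, hM₁cl, hTO₁, hreg₁⟩

end Climb

/-- **The purely inseparable part of Cossart–Piltant's climb, in the shape of the climbing
hypothesis of `cossartPiltant2019ReductionP_of_climb`** (`ArithmeticalThreefoldsReduction.lean`):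
for `S` an excellent regular local domain of dimension three and residue characteristic `p`,
`Ω ⊇ S` a field of characteristic `p` algebraic over `S`, `O_Ω ∋ S` a valuation ring dominating
`S` with residue field algebraic over `S/𝔪_S`, and a finite `s₀ ⊆ Ω` generating over
`F = Frac S` a PURELY INSEPARABLE extension `K = F(s₀)` (`z^{p^k} ∈ F` for all `z ∈ K`): there is
a model `S[t] ⊆ O_Ω` with `t ⊆ K ⊆ F(t)` regular at the centre of `O_Ω`. The separable
(ramification-theoretic) part of the climb is not treated here.
[cite: CossartPiltant2019, proof of Prop. 4.10 (arXiv v1: Prop. 4.8, p. 54) with Thm. 1.5 (i)] -/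
theorem CossartPiltant2019Local.climb_of_forall_pow_mem {S Ω : Type u} [CommRing S]
    [IsRegularLocalRing S] [Field Ω] [Algebra S Ω] (OΩ : ValuationSubring Ω)
    (hloc : CossartPiltant2019Local.{u}) (p : ℕ) [hp : Fact p.Prime] [CharP Ω p]
    [Algebra.IsAlgebraic S Ω] (hinj : Function.Injective (algebraMap S Ω))
    (hS : IsExcellentRing S) (hSdim : ringKrullDim S = 3) (hSchar : CharP (ResidueField S) p)
    (hSO : ∀ s : S, algebraMap S Ω s ∈ OΩ)
    (hdom : ∀ s ∈ maximalIdeal S, OΩ.valuation (algebraMap S Ω s) < 1)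
    (hres : ∀ y : OΩ, ∃ q : S[X], (∃ i, q.coeff i ∉ maximalIdeal S) ∧
      OΩ.valuation (q.eval₂ (algebraMap S Ω) y) < 1)
    (s₀ : Finset Ω)
    (hfin : 0 < Subfield.relfinrank (Subfield.closure (Set.range (algebraMap S Ω)))
      (Subfield.closure (Set.range (algebraMap S Ω) ∪ (s₀ : Set Ω))))
    (hpi : ∀ z ∈ Subfield.closure (Set.range (algebraMap S Ω) ∪ (s₀ : Set Ω)), ∃ k : ℕ,
      z ^ p ^ k ∈ Subfield.closure (Set.range (algebraMap S Ω))) :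
    ∃ t : Finset Ω,
      (t : Set Ω) ⊆ Subfield.closure (Set.range (algebraMap S Ω) ∪ (s₀ : Set Ω)) ∧
      (s₀ : Set Ω) ⊆ Subfield.closure (Set.range (algebraMap S Ω) ∪ (t : Set Ω)) ∧
      ∃ hTO : (Algebra.adjoin S (t : Set Ω)).toSubring ≤ OΩ.toSubring,
        IsRegularLocalRing (Localization.AtPrime
          (Ideal.comap (Subring.inclusion hTO) (maximalIdeal OΩ))) := by
  classical
  haveI : IsDomain S := isDomain_of_isRegularLocalRing S
  set F₀ : Subfield Ω := Subfield.closure (Set.range (algebraMap S Ω)) with hF₀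
  set K₀ : Subfield Ω := Subfield.closure (Set.range (algebraMap S Ω) ∪ (s₀ : Set Ω)) with hK₀
  have hFK : F₀ ≤ K₀ := Subfield.closure_mono Set.subset_union_left
  have hSF : ∀ s : S, algebraMap S Ω s ∈ F₀ := fun s => Subfield.subset_closure ⟨s, rfl⟩
  -- the base: `S[∅]`
  have hTO₀ : (Algebra.adjoin S (((∅ : Finset Ω) : Finset Ω) : Set Ω)).toSubring ≤ OΩ.toSubring := by
    intro w hw
    rw [Finset.coe_empty, Algebra.adjoin_empty] at hw
    obtain ⟨s, rfl⟩ := Algebra.mem_bot.mp (show w ∈ (⊥ : Subalgebra S Ω) from hw)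
    exact hSO s
  have hINV₀ : ∃ t : Finset Ω, (t : Set Ω) ⊆ F₀ ∧
      F₀ ≤ Subfield.closure (Set.range (algebraMap S Ω) ∪ (t : Set Ω)) ∧
      ∃ hTO : (Algebra.adjoin S (t : Set Ω)).toSubring ≤ OΩ.toSubring,
        IsRegularLocalRing (Localization.AtPrime
          (Ideal.comap (Subring.inclusion hTO) (maximalIdeal OΩ))) :=
    ⟨∅, by simp, by rw [Finset.coe_empty, Set.union_empty], hTO₀,
      isRegularLocalRing_centre_adjoin_empty hinj OΩ hSO hdom hTO₀⟩
  obtain ⟨t, htK, hKcl, hTO, hreg⟩ :=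
    CossartPiltant2019Local.exists_model_of_forall_pow_mem OΩ hloc p hinj hS hSdim hSchar hSO hdom
      hres _ F₀ K₀ hFK hSF hpi rfl hfin hINV₀
  exact ⟨t, htK, fun w hw => hKcl (Subfield.subset_closure (Set.mem_union_right _ hw)), hTO, hreg⟩


end Literature.AlgebraicGeometry.Resolution
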